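import Literature.MathematicalPhysics.QuantumLattice.FermionOperatorsProofs
import Literature.MathematicalPhysics.QuantumLattice.HubbardWave0Proofs
import HarnessLib

/-!
# First quantisation on the fermionic Fock space: `|g⟩ = Σ_o g(o) c†_{o₀} ⋯ c†_{o_{N-1}} |∅⟩`

Trunk T-QLATTICE, topic `MathematicalPhysics/QuantumLattice`. The passage between `N`-particle
Fock vectors and coefficient functions ("wave functions") of `N` labelled particles, as in
F. H. L. Essler, H. Frahm, F. Göhmann, A. Klümper, V. E. Korepin, *The One-Dimensional Hubbard
Model* (CUP 2005), §3.1, eqs. (3.3)–(3.13) (held: `book:essler2005-one-dimensional-hubbard-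
model`, PDF pp. 81–82), for the tree's concrete Jordan–Wigner Fock space
`Fock ι = Finset ι → ℂ` of `HubbardWave0` (`creation`, `annihilation`, `vacuum`) and the Hubbard
Hamiltonian `hamiltonian G t U` on `Orb Λ = Λ ×ₗ Fin 2`. It is the bridge by which a solution of
the first-quantised Schrödinger equation (Essler (3.12)/(3.16)–(3.17)) — e.g. a Bethe-ansatz wave
function — becomes an eigenvector of the second-quantised Hamiltonian; together with
`XXXAlgebraicBetheAnsatz.lean` it prepares the Bethe-ansatz eigenvector theorem for the Hubbard
chain (census item (1) of node F2c of `lieb_wu`, module docstring of `LiebWuBetheAnsatz.lean`).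

## Contents (all statements proved; no named facts)

* `FirstQuant.prodCreation o = c†_{o 0} ⋯ c†_{o (N-1)}` for `o : Fin N → ι`, and
  `FirstQuant.slater g = Σ_o g(o) • (C†(o)|∅⟩)`, Essler's `|ψ⟩ = (1/N!) Σ_{x,a} ψ(x;a)|x,a⟩`
  (3.13) without the factor `1/N!` and with the `N` labels running over orbitals `ι` (for the
  Hubbard model `ι = Orb Λ`, an orbital is a pair (site, spin), so `o` encodes `(x, a)`).
* `FirstQuant.hop1 i j g (o) = Σ_l [o_l = i] g(o[l ↦ j])`, the first-quantised one-body operator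
  `Σ_l (|i⟩⟨j|)_l`, and the **second-quantisation identity**
  `creation_annihilation_mulVec_slater : c†_i c_j |g⟩ = |hop1 i j g⟩` for EVERY coefficient
  function `g` (no antisymmetry needed), from the commutator formula
  `c†_i c_j C†(o) = Σ_l [o_l = j] C†(o[l ↦ i]) + C†(o) c†_i c_j` (`creation_annihilation_prodCreation`,
  Essler (3.4)–(3.7)) and `c_j|∅⟩ = 0`.
* `FirstQuant.hamiltonian_mulVec_slater : hamiltonian G t U *ᵥ slater g = slater (firstQuantH G t U g)`
  with the first-quantised Hubbard Hamiltonian `firstQuantH` and its coordinate form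
  `firstQuantH_apply`: `(H_N g)(o) = -t Σ_l Σ_{y ∼ x_l} g(o[l ↦ (y,σ_l)])
  + U Σ_x #{l : o_l = x↑} #{l : o_l = x↓} g(o)` (Essler (3.8)–(3.10); on a ring the hopping term is
  the cyclic shift operators `Δ^±_{j,L}` of (3.9)).
* The bridge to Mathlib's exterior algebra (`fockExteriorEquiv`, `creation_eq_wedge_holds` of
  `FermionOperators`): `C†(o)|∅⟩ ↦ e_{o 0} ∧ ⋯ ∧ e_{o (N-1)} = ιMulti`, whence antisymmetry
  `C†(o ∘ σ)|∅⟩ = sign σ • C†(o)|∅⟩`, the Pauli principle `C†(o)|∅⟩ = 0` for non-injective `o`,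
  `C†(increasing enumeration of s)|∅⟩ = |s⟩`, and the **coefficient formula**
  `slater_apply_of_antisymm : ⟨s|g⟩ = N! · g(s↑)` for antisymmetric `g` (Essler (3.3) ↔ (3.13):
  "(3.3) and (3.13) are mutually inverse"), so `|g⟩ = 0` iff `g` vanishes on injective
  configurations.
* Sector bookkeeping: `isNParticle_slater`, `slater_apply_eq_zero_of_spin_count` (support in the
  joint `(N_↑, N_↓)` sector when `g` is so supported), `slater_congr_injective`.

## Conventions

`C†(o) = c†_{o 0} c†_{o 1} ⋯` with `o 0` leftmost (so `c†_{o (N-1)}` acts first on `|∅⟩`); with the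
Jordan–Wigner signs of `HubbardWave0` the increasing enumeration creates `|s⟩` with coefficient
`+1` (`prodCreation_orderEmbOfFin_vacuum`). Spins: `0 = ↑`, `1 = ↓` (`orb x σ`).

## Not in this file

Translation/shift operators (Essler (3.18)–(3.22)), the infinite-lattice difference equation
(3.14)–(3.17) (these belong to the Bethe-ansatz wave-function file), norms `(3.11)`.

## References

* F. H. L. Essler et al., *The One-Dimensional Hubbard Model*, CUP 2005, §2.1 eqs. (2.2), (2.6)
  and §3.1 eqs. (3.3)–(3.13) (key `EsslerEtAl2005`; held, PDF pp. 81–82).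
* O. Bratteli, D. W. Robinson, *Operator Algebras and Quantum Statistical Mechanics II*, §5.2.1
  (antisymmetric Fock space as an exterior algebra). [BratteliRobinsonII1997]
-/

noncomputable section

namespace Literature.MathematicalPhysics.QuantumLattice

open Matrix Finset

namespace FirstQuant

section General

variable {ι : Type*} [LinearOrder ι] [Fintype ι]

/-- The ordered product of creation operators `c†_{o 0} c†_{o 1} ⋯ c†_{o (N-1)}`.
[cite: EsslerEtAl2005, eq. (2.6)] -/
def prodCreation {N : ℕ} (o : Fin N → ι) : Matrix (Finset ι) (Finset ι) ℂ :=
  (List.ofFn fun l => creation (o l)).prod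

/-- The empty creation string is `1`. [folklore] -/
@[simp] theorem prodCreation_zero (o : Fin 0 → ι) : prodCreation o = 1 := by
  simp [prodCreation]

/-- `C†(o) = c†_{o 0} C†(tail o)`. [folklore] -/
theorem prodCreation_succ {N : ℕ} (o : Fin (N + 1) → ι) :
    prodCreation o = creation (o 0) * prodCreation (Fin.tail o) := by
  rw [prodCreation, List.ofFn_succ, List.prod_cons]
  rfl

/-- The `N`-particle vector with coefficient function `g`:
`|g⟩ = Σ_o g(o) c†_{o 0} ⋯ c†_{o (N-1)} |∅⟩` (Essler et al. (3.13) without the factor `1/N!`).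
[cite: EsslerEtAl2005, eq. (3.13)] -/
def slater {N : ℕ} (g : (Fin N → ι) → ℂ) : Fock ι :=
  ∑ o : Fin N → ι, g o • (prodCreation o *ᵥ vacuum)

/-- The first-quantised one-body operator `|i⟩⟨j|` summed over the particles:
`(hop1 i j g)(o) = Σ_l [o l = i] g(o[l ↦ j])`. [cite: EsslerEtAl2005, eqs. (3.6)–(3.7)] -/
def hop1 {N : ℕ} (i j : ι) (g : (Fin N → ι) → ℂ) : (Fin N → ι) → ℂ :=
  fun o => ∑ l : Fin N, if o l = i then g (Function.update o l j) else 0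

/-- `g ↦ |g⟩` is additive. [cite: EsslerEtAl2005, eq. (3.13)] -/
theorem slater_add {N : ℕ} (g g' : (Fin N → ι) → ℂ) : slater (g + g') = slater g + slater g' := by
  simp only [slater, Pi.add_apply, add_smul, Finset.sum_add_distrib]

/-- `g ↦ |g⟩` is homogeneous. [cite: EsslerEtAl2005, eq. (3.13)] -/
theorem slater_smul {N : ℕ} (c : ℂ) (g : (Fin N → ι) → ℂ) : slater (c • g) = c • slater g := by
  simp only [slater, Pi.smul_apply, smul_eq_mul, mul_smul, Finset.smul_sum]

/-- `g ↦ |g⟩` commutes with finite sums. [cite: EsslerEtAl2005, eq. (3.13)] -/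
theorem slater_sum {N : ℕ} {κ : Type*} (S : Finset κ) (g : κ → (Fin N → ι) → ℂ) :
    slater (∑ k ∈ S, g k) = ∑ k ∈ S, slater (g k) := by
  classical
  induction S using Finset.induction_on with
  | empty => simp [slater]
  | insert a S ha ih => rw [Finset.sum_insert ha, Finset.sum_insert ha, slater_add, ih]

/-- `|0⟩ = 0`. [folklore] -/
theorem slater_zero {N : ℕ} : slater (0 : (Fin N → ι) → ℂ) = 0 := by
  simp [slater]

/-- CAR step: `c†_i c_j c†_k = δ_{jk} c†_i + c†_k c†_i c_j`. [cite: EsslerEtAl2005, eq. (3.4)] -/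
theorem creation_annihilation_creation (i j k : ι) :
    creation i * annihilation j * creation k =
      (if j = k then creation i else 0) + creation k * (creation i * annihilation j) := by
  rw [mul_assoc, annihilation_mul_creation, mul_sub, ← mul_assoc, ← mul_assoc,
    creation_mul_creation_eq_neg i k]
  split_ifs
  · rw [mul_one, neg_mul, sub_neg_eq_add, mul_assoc]
  · rw [mul_zero, neg_mul, zero_sub, neg_neg, zero_add, mul_assoc]

/-- **Commutator of a one-body operator with a string of creation operators**:
`c†_i c_j C†(o) = Σ_l [o_l = j] C†(o[l ↦ i]) + C†(o) c†_i c_j`.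
[cite: EsslerEtAl2005, eqs. (3.4)–(3.6)] -/
theorem creation_annihilation_prodCreation {N : ℕ} (i j : ι) (o : Fin N → ι) :
    creation i * annihilation j * prodCreation o =
      (∑ l : Fin N, if o l = j then prodCreation (Function.update o l i) else 0) +
        prodCreation o * (creation i * annihilation j) := by
  induction N with
  | zero => simp
  | succ N ih =>
      rw [prodCreation_succ, ← mul_assoc, creation_annihilation_creation, add_mul, mul_assoc,
        ih (Fin.tail o), mul_add, ← mul_assoc, Fin.sum_univ_succ, Finset.mul_sum]
      have h0 : (if o 0 = j then prodCreation (Function.update o 0 i) else 0) =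
          (if j = o 0 then creation i else 0) * prodCreation (Fin.tail o) := by
        by_cases h : o 0 = j
        · rw [if_pos h, if_pos h.symm, prodCreation_succ, Function.update_self, Fin.tail_update_zero]
        · rw [if_neg h, if_neg (Ne.symm h), zero_mul]
      have hs : ∀ l : Fin N, (if o l.succ = j then prodCreation (Function.update o l.succ i) else 0) =
          creation (o 0) * (if Fin.tail o l = j then prodCreation (Function.update (Fin.tail o) l i)
            else 0) := by
        intro l
        by_cases h : o l.succ = j
        · have h' : Fin.tail o l = j := h
          rw [if_pos h, if_pos h', prodCreation_succ, Function.update_of_ne (Fin.succ_ne_zero l).symm,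
            Fin.tail_update_succ]
        · have h' : ¬Fin.tail o l = j := h
          rw [if_neg h, if_neg h', mul_zero]
      simp only [h0, hs]
      abel

/-- **Second quantisation of one-body operators**: `c†_i c_j |g⟩ = |hop1 i j g⟩`.
[cite: EsslerEtAl2005, eqs. (3.6)–(3.8)] -/
theorem creation_annihilation_mulVec_slater {N : ℕ} (i j : ι) (g : (Fin N → ι) → ℂ) :
    (creation i * annihilation j) *ᵥ slater g = slater (hop1 i j g) := by
  have hvac : annihilation j *ᵥ (vacuum : Fock ι) = 0 := annihilation_mulVec_vacuum_holds j
  calc (creation i * annihilation j) *ᵥ slater g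
      = ∑ o : Fin N → ι, g o • ∑ l : Fin N,
          if o l = j then prodCreation (Function.update o l i) *ᵥ (vacuum : Fock ι) else 0 := by
        simp only [slater, Matrix.mulVec_sum, Matrix.mulVec_smul]
        refine Finset.sum_congr rfl fun o _ => ?_
        congr 1
        rw [Matrix.mulVec_mulVec, creation_annihilation_prodCreation, add_mulVec,
          ← Matrix.mulVec_mulVec, ← Matrix.mulVec_mulVec, hvac, mulVec_zero, mulVec_zero, add_zero,
          Matrix.sum_mulVec]
        refine Finset.sum_congr rfl fun l _ => ?_
        split_ifs
        · rfl
        · rw [zero_mulVec]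
    _ = ∑ l : Fin N, ∑ o : Fin N → ι,
          if o l = j then g o • (prodCreation (Function.update o l i) *ᵥ (vacuum : Fock ι)) else 0 := by
        rw [Finset.sum_comm]
        refine Finset.sum_congr rfl fun o _ => ?_
        rw [Finset.smul_sum]
        refine Finset.sum_congr rfl fun l _ => ?_
        split_ifs <;> simp
    _ = ∑ l : Fin N, ∑ o : Fin N → ι,
          if o l = i then g (Function.update o l j) • (prodCreation o *ᵥ (vacuum : Fock ι)) else 0 := by
        refine Finset.sum_congr rfl fun l _ => ?_
        -- reindex the right-hand side by the involution swapping the values `i`, `j` at `l`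
        let e : (Fin N → ι) ≃ (Fin N → ι) :=
          { toFun := fun o => Function.update o l (Equiv.swap i j (o l))
            invFun := fun o => Function.update o l (Equiv.swap i j (o l))
            left_inv := fun o => by simp
            right_inv := fun o => by simp }
        rw [← Equiv.sum_comp e (fun o => if o l = i then
          g (Function.update o l j) • (prodCreation o *ᵥ (vacuum : Fock ι)) else 0)]
        refine Finset.sum_congr rfl fun o _ => ?_
        simp only [e, Equiv.coe_fn_mk, Function.update_self, Function.update_idem]
        by_cases h : o l = j
        · rw [if_pos h, h, Equiv.swap_apply_right, if_pos rfl, ← h, Function.update_eq_self]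
        · rw [if_neg h, if_neg]
          intro h'
          rcases eq_or_ne (o l) i with h2 | h2
          · rw [h2, Equiv.swap_apply_left] at h'
            exact h (h2.trans h'.symm)
          · rw [Equiv.swap_apply_of_ne_of_ne h2 h] at h'
            exact h2 h'
    _ = slater (hop1 i j g) := by
        rw [slater, Finset.sum_comm]
        refine Finset.sum_congr rfl fun o _ => ?_
        rw [hop1, Finset.sum_smul]
        refine Finset.sum_congr rfl fun l _ => ?_
        split_ifs <;> simp

/-- `C†(o)|∅⟩` lies in the `N`-particle sector. [folklore] -/
theorem isNParticle_prodCreation_vacuum {N : ℕ} (o : Fin N → ι) :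
    IsNParticle N (prodCreation o *ᵥ (vacuum : Fock ι)) := by
  induction N with
  | zero =>
      intro s hs
      rw [prodCreation_zero, one_mulVec, vacuum, Pi.single_apply, if_neg]
      intro h
      exact hs (by rw [h, Finset.card_empty])
  | succ N ih =>
      rw [prodCreation_succ, ← mulVec_mulVec]
      exact IsNParticle.creation_mulVec_holds (ih (Fin.tail o)) (o 0)

/-- `|g⟩` lies in the `N`-particle sector. [cite: EsslerEtAl2005, §3.1] -/
theorem isNParticle_slater {N : ℕ} (g : (Fin N → ι) → ℂ) : IsNParticle N (slater g) := by
  intro s hs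
  rw [slater, Finset.sum_apply]
  refine Finset.sum_eq_zero fun o _ => ?_
  rw [Pi.smul_apply, isNParticle_prodCreation_vacuum o s hs, smul_zero]

/-- Coefficients of `|g⟩` vanish off the `N`-particle configurations. [folklore] -/
theorem slater_apply_of_card_ne {N : ℕ} (g : (Fin N → ι) → ℂ) {s : Finset ι} (hs : s.card ≠ N) :
    slater g s = 0 :=
  isNParticle_slater g s hs

/-! ### The bridge to the exterior algebra: `C†(o)|∅⟩ ↦ e_{o 0} ∧ ⋯ ∧ e_{o (N-1)}` -/

/-- Under `fockExteriorEquiv`, `C†(o)|∅⟩` is the wedge `e_{o 0} ∧ ⋯ ∧ e_{o (N-1)}`.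
[cite: BratteliRobinsonII1997, §5.2.1] -/
theorem fockExteriorEquiv_prodCreation_vacuum {N : ℕ} (o : Fin N → ι) :
    fockExteriorEquiv (prodCreation o *ᵥ (vacuum : Fock ι)) =
      ExteriorAlgebra.ιMulti ℂ N (fun l => (Pi.single (o l) (1 : ℂ) : ι → ℂ)) := by
  induction N with
  | zero =>
      rw [prodCreation_zero, one_mulVec, ExteriorAlgebra.ιMulti_zero_apply, vacuum,
        fockExteriorEquiv_single, basisExteriorAlgebra_eq_ιMulti _ (Finset.card_empty),
        ExteriorAlgebra.ιMulti_zero_apply]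
  | succ N ih =>
      rw [prodCreation_succ, ← mulVec_mulVec, creation_eq_wedge_holds, ih (Fin.tail o),
        ExteriorAlgebra.ιMulti_succ_apply]
      rfl

/-- **Antisymmetry of the creation string**: `C†(o ∘ σ)|∅⟩ = sign(σ) C†(o)|∅⟩`.
[cite: EsslerEtAl2005, eq. (2.2a)] -/
theorem prodCreation_vacuum_perm {N : ℕ} (o : Fin N → ι) (σ : Equiv.Perm (Fin N)) :
    prodCreation (o ∘ σ) *ᵥ (vacuum : Fock ι) =
      ((Equiv.Perm.sign σ : ℤ) : ℂ) • (prodCreation o *ᵥ (vacuum : Fock ι)) := by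
  apply fockExteriorEquiv.injective
  rw [map_smul, fockExteriorEquiv_prodCreation_vacuum, fockExteriorEquiv_prodCreation_vacuum,
    show (fun l => (Pi.single ((o ∘ σ) l) (1 : ℂ) : ι → ℂ)) =
      (fun l => (Pi.single (o l) (1 : ℂ) : ι → ℂ)) ∘ σ from rfl,
    AlternatingMap.map_perm, Units.smul_def, Int.cast_smul_eq_zsmul]

/-- **Pauli principle**: `C†(o)|∅⟩ = 0` if two of the orbitals `o l` coincide.
[cite: EsslerEtAl2005, §2.1] -/
theorem prodCreation_vacuum_of_not_injective {N : ℕ} (o : Fin N → ι) (ho : ¬Function.Injective o) :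
    prodCreation o *ᵥ (vacuum : Fock ι) = 0 := by
  apply fockExteriorEquiv.injective
  rw [fockExteriorEquiv_prodCreation_vacuum, map_zero]
  refine AlternatingMap.map_eq_zero_of_not_injective _ _ fun h => ho ?_
  intro a b hab
  exact h (by simp only [hab])

/-- The creation string of the increasing enumeration of `s` creates the basis vector `|s⟩`.
[cite: EsslerEtAl2005, eq. (2.6)] -/
theorem prodCreation_orderEmbOfFin_vacuum {N : ℕ} (s : Finset ι) (h : s.card = N) :
    prodCreation (fun l => s.orderEmbOfFin h l) *ᵥ (vacuum : Fock ι) = Pi.single s 1 := by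
  apply fockExteriorEquiv.injective
  rw [fockExteriorEquiv_prodCreation_vacuum, fockExteriorEquiv_single,
    basisExteriorAlgebra_eq_ιMulti _ h]
  congr 1
  funext l
  rw [Function.comp_apply, Pi.basisFun_apply]

/-- `|g⟩` only depends on the values of `g` at injective `o` (duplicate-free configurations).
[folklore] -/
theorem slater_congr_injective {N : ℕ} {g g' : (Fin N → ι) → ℂ}
    (h : ∀ o, Function.Injective o → g o = g' o) : slater g = slater g' := by
  unfold slater
  refine Finset.sum_congr rfl fun o _ => ?_
  by_cases ho : Function.Injective o
  · rw [h o ho]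
  · rw [prodCreation_vacuum_of_not_injective o ho, smul_zero, smul_zero]

/-! ### Coefficients of `|g⟩` for antisymmetric `g` (Essler et al. (3.3), (3.13)) -/

omit [Fintype ι] in
/-- An injective configuration is a permutation of the increasing enumeration of its range.
[folklore] -/
theorem exists_perm_eq_orderEmbOfFin_comp {N : ℕ} (o : Fin N → ι) (ho : Function.Injective o) :
    ∃ (ht : (Finset.univ.image o).card = N) (π : Equiv.Perm (Fin N)),
      o = (fun l => (Finset.univ.image o).orderEmbOfFin ht l) ∘ π := by
  have ht : (Finset.univ.image o).card = N := by
    rw [Finset.card_image_of_injective _ ho, Finset.card_univ, Fintype.card_fin]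
  refine ⟨ht, ?_⟩
  set t := Finset.univ.image o with htdef
  let f : Fin N → Fin N := fun l => (t.orderIsoOfFin ht).symm ⟨o l, Finset.mem_image_of_mem o (mem_univ l)⟩
  have hf : Function.Injective f := by
    intro a b hab
    have := congr_arg (fun i => ((t.orderIsoOfFin ht) i : ι)) hab
    simp only [f, OrderIso.apply_symm_apply] at this
    exact ho this
  refine ⟨Equiv.ofBijective f hf.bijective_of_finite, ?_⟩
  funext l
  simp only [Function.comp_apply, Equiv.ofBijective_apply, f]
  rw [← Finset.coe_orderIsoOfFin_apply, OrderIso.apply_symm_apply]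

/-- Coefficient of the creation string of an injective configuration:
`⟨s| C†(e_t ∘ π) |∅⟩ = [t = s] sign π`. [folklore] -/
theorem prodCreation_vacuum_apply_of_perm {N : ℕ} (t : Finset ι) (ht : t.card = N)
    (π : Equiv.Perm (Fin N)) (s : Finset ι) :
    (prodCreation ((fun l => t.orderEmbOfFin ht l) ∘ π) *ᵥ (vacuum : Fock ι)) s =
      if t = s then ((Equiv.Perm.sign π : ℤ) : ℂ) else 0 := by
  rw [prodCreation_vacuum_perm, prodCreation_orderEmbOfFin_vacuum, Pi.smul_apply, Pi.single_apply,
    smul_eq_mul]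
  by_cases h : t = s
  · rw [if_pos h, if_pos h.symm, mul_one]
  · rw [if_neg h, if_neg (Ne.symm h), mul_zero]

/-- **Wave function ↔ state** (Essler et al. (3.3), (3.13)): for an antisymmetric coefficient
function `g`, the coefficient of `|g⟩ = Σ_o g(o) C†(o)|∅⟩` on the basis vector `|s⟩`,
`s = {i₀ < ⋯ < i_{N-1}}`, is `N! · g(i₀, …, i_{N-1})`. In particular `|g⟩ = 0` iff `g` vanishes
on increasing (equivalently, on all injective) configurations.
[cite: EsslerEtAl2005, eqs. (3.3), (3.13)] -/
theorem slater_apply_of_antisymm {N : ℕ} (g : (Fin N → ι) → ℂ)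
    (hg : ∀ (σ : Equiv.Perm (Fin N)) (o : Fin N → ι),
      g (o ∘ σ) = ((Equiv.Perm.sign σ : ℤ) : ℂ) * g o)
    (s : Finset ι) (h : s.card = N) :
    slater g s = (N.factorial : ℂ) * g (fun l => s.orderEmbOfFin h l) := by
  set e : Fin N → ι := fun l => s.orderEmbOfFin h l with he
  have heinj : Function.Injective e := fun a b hab => (s.orderEmbOfFin h).injective hab
  have hcomp : Function.Injective (fun π : Equiv.Perm (Fin N) => e ∘ (π : Fin N → Fin N)) := by
    intro π π' hπ
    ext l
    have := congr_fun hπ l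
    exact congr_arg Fin.val (heinj this)
  rw [slater, Finset.sum_apply]
  -- restrict the sum to the permutations of the increasing enumeration of `s`
  rw [← Finset.sum_subset (Finset.subset_univ (Finset.univ.image fun π : Equiv.Perm (Fin N) => e ∘ π))]
  · rw [Finset.sum_image fun π _ π' _ hπ => hcomp hπ]
    simp only [Pi.smul_apply, smul_eq_mul]
    have hterm : ∀ π : Equiv.Perm (Fin N),
        g (e ∘ π) * (prodCreation (e ∘ π) *ᵥ (vacuum : Fock ι)) s = g e := by
      intro π
      rw [hg, he, prodCreation_vacuum_apply_of_perm s h π s, if_pos rfl]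
      rw [mul_comm (((Equiv.Perm.sign π : ℤ) : ℂ)) (g _), mul_assoc, ← Int.cast_mul,
        ← Units.val_mul, Int.units_mul_self, Units.val_one, Int.cast_one, mul_one]
    simp only [hterm, Finset.sum_const, Finset.card_univ, Fintype.card_perm, Fintype.card_fin,
      nsmul_eq_mul]
  · intro o _ ho
    rw [Pi.smul_apply, smul_eq_mul]
    by_cases hinj : Function.Injective o
    · obtain ⟨ht, π, hπ⟩ := exists_perm_eq_orderEmbOfFin_comp o hinj
      rw [hπ, prodCreation_vacuum_apply_of_perm, if_neg, mul_zero]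
      intro hts
      apply ho
      subst hts
      exact Finset.mem_image.2 ⟨π, mem_univ _, hπ.symm⟩
    · rw [prodCreation_vacuum_of_not_injective o hinj, Pi.zero_apply, mul_zero]

end General

/-! ### The Hubbard Hamiltonian in first quantisation -/

section Hubbard

variable {Λ : Type*} [LinearOrder Λ] [Fintype Λ] (G : SimpleGraph Λ) [DecidableRel G.Adj]

/-- The Hubbard Hamiltonian acting on coefficient functions of `N` labelled electrons
(first quantisation): hopping of each electron along the bonds of `G` with its spin kept, and
`U` times the number of doubly occupied sites,
`(H_N g)(o) = -t Σ_{x∼y,σ} (|xσ⟩⟨yσ|)^{(1)} g + U Σ_x n^{(1)}_{x↑} n^{(1)}_{x↓} g`.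
[cite: EsslerEtAl2005, eqs. (3.8)–(3.10)] -/
def firstQuantH (t U : ℝ) {N : ℕ} (g : (Fin N → Orb Λ) → ℂ) : (Fin N → Orb Λ) → ℂ :=
  -(t : ℂ) • (∑ x : Λ, ∑ y : Λ, ∑ σ : Fin 2, if G.Adj x y then hop1 (orb x σ) (orb y σ) g else 0) +
    (U : ℂ) • ∑ x : Λ, hop1 (orb x 0) (orb x 0) (hop1 (orb x 1) (orb x 1) g)

/-- **Second quantisation of the Hubbard Hamiltonian** (Essler et al. (3.8)–(3.13)):
`H |g⟩ = |H_N g⟩` for every coefficient function `g` of `N` labelled electrons.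
[cite: EsslerEtAl2005, eqs. (3.8)–(3.13)] -/
theorem hamiltonian_mulVec_slater (t U : ℝ) {N : ℕ} (g : (Fin N → Orb Λ) → ℂ) :
    hamiltonian G t U *ᵥ slater g = slater (firstQuantH G t U g) := by
  have hhop : (∑ x : Λ, ∑ y : Λ, ∑ σ : Fin 2,
      if G.Adj x y then creation (orb x σ) * annihilation (orb y σ) else (0 : Matrix _ _ ℂ)) *ᵥ
        slater g =
      slater (∑ x : Λ, ∑ y : Λ, ∑ σ : Fin 2, if G.Adj x y then hop1 (orb x σ) (orb y σ) g else 0) := by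
    simp only [Matrix.sum_mulVec, slater_sum]
    refine Finset.sum_congr rfl fun x _ => Finset.sum_congr rfl fun y _ =>
      Finset.sum_congr rfl fun σ _ => ?_
    split_ifs
    · exact creation_annihilation_mulVec_slater _ _ g
    · rw [zero_mulVec, slater_zero]
  have hint : (∑ x : Λ, numberOp x 0 * numberOp x 1) *ᵥ slater g =
      slater (∑ x : Λ, hop1 (orb x 0) (orb x 0) (hop1 (orb x 1) (orb x 1) g)) := by
    simp only [Matrix.sum_mulVec, slater_sum]
    refine Finset.sum_congr rfl fun x _ => ?_
    rw [← mulVec_mulVec, numberOp, numberOp, creation_annihilation_mulVec_slater,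
      creation_annihilation_mulVec_slater]
  rw [hamiltonian, add_mulVec, smul_mulVec, smul_mulVec, hhop, hint, firstQuantH, slater_add,
    slater_smul, slater_smul]

omit [Fintype Λ] [DecidableRel G.Adj] in
/-- A sum over orbitals against the indicator of one orbital collapses. [folklore] -/
theorem sum_sum_ite_eq_orb {M : Type*} [AddCommMonoid M] [Fintype Λ] (i : Orb Λ) (F : Λ → Fin 2 → M) :
    (∑ x : Λ, ∑ σ : Fin 2, if i = orb x σ then F x σ else 0) = F (ofLex i).1 (ofLex i).2 := by
  have hi : i = orb (ofLex i).1 (ofLex i).2 := rfl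
  rw [← Finset.sum_product']
  rw [Finset.sum_eq_single ((ofLex i).1, (ofLex i).2)]
  · rw [if_pos hi]
  · rintro ⟨x, σ⟩ _ hne
    rw [if_neg]
    intro h
    apply hne
    rw [h]
    rfl
  · intro h
    exact absurd (Finset.mem_univ _) h

omit [LinearOrder Λ] [Fintype Λ] [DecidableRel G.Adj] in
/-- `Σ_l [p l] c = #{l | p l} · c`. [folklore] -/
theorem sum_ite_const_eq_card_mul {N : ℕ} (p : Fin N → Prop) [DecidablePred p] (c : ℂ) :
    (∑ l : Fin N, if p l then c else 0) = ((Finset.univ.filter p).card : ℂ) * c := by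
  rw [← Finset.sum_filter, Finset.sum_const, nsmul_eq_mul]

omit [Fintype Λ] [DecidableRel G.Adj] in
/-- A diagonal one-body operator counts labels: `(n^{(1)}_b g)(o) = #{l : o_l = b} · g(o)`.
[folklore] -/
theorem hop1_self_apply {N : ℕ} (b : Orb Λ) (g : (Fin N → Orb Λ) → ℂ) (o : Fin N → Orb Λ) :
    hop1 b b g o = ((Finset.univ.filter fun l => o l = b).card : ℂ) * g o := by
  rw [hop1, ← sum_ite_const_eq_card_mul]
  refine Finset.sum_congr rfl fun l _ => ?_
  split_ifs with h
  · rw [← h, Function.update_eq_self]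
  · rfl

omit [Fintype Λ] [DecidableRel G.Adj] in
/-- `n^{(1)}_a n^{(1)}_b g = #{l : o_l = a} · #{l : o_l = b} · g` (diagonal one-body operators).
[folklore] -/
theorem hop1_self_hop1_self_apply {N : ℕ} (a b : Orb Λ) (g : (Fin N → Orb Λ) → ℂ) (o : Fin N → Orb Λ) :
    hop1 a a (hop1 b b g) o =
      ((Finset.univ.filter fun l => o l = a).card : ℂ) * ((Finset.univ.filter fun l => o l = b).card : ℂ) *
        g o := by
  rw [hop1_self_apply, hop1_self_apply, mul_assoc]

/-- **Coordinate form of the first-quantised Hubbard Hamiltonian**: each electron `l` hops from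
its site to an adjacent site keeping its spin, and the interaction counts pairs of labels sitting
at the same site with spins `↑`, `↓`:
`(H_N g)(o) = -t Σ_l Σ_{y ∼ x_l} g(o[l ↦ (y, σ_l)]) + U Σ_x #{l : o_l = x↑} #{l : o_l = x↓} g(o)`
(for injective `o` the last sum is the number of doubly occupied sites; Essler et al. (3.10),
(3.15)). [cite: EsslerEtAl2005, eqs. (3.8)–(3.10)] -/
theorem firstQuantH_apply (t U : ℝ) {N : ℕ} (g : (Fin N → Orb Λ) → ℂ) (o : Fin N → Orb Λ) :
    firstQuantH G t U g o =
      -(t : ℂ) * (∑ l : Fin N, ∑ y : Λ, if G.Adj (ofLex (o l)).1 y then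
          g (Function.update o l (orb y (ofLex (o l)).2)) else 0) +
        (U : ℂ) * ∑ x : Λ, ((Finset.univ.filter fun l => o l = orb x 0).card : ℂ) *
          ((Finset.univ.filter fun l => o l = orb x 1).card : ℂ) * g o := by
  rw [firstQuantH, Pi.add_apply, Pi.smul_apply, Pi.smul_apply, smul_eq_mul, smul_eq_mul]
  congr 2
  · -- hopping part
    simp only [Finset.sum_apply]
    have h1 : ∀ (x y : Λ) (σ : Fin 2),
        (if G.Adj x y then hop1 (orb x σ) (orb y σ) g else (0 : (Fin N → Orb Λ) → ℂ)) o =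
          ∑ l : Fin N, if o l = orb x σ then
            (if G.Adj x y then g (Function.update o l (orb y σ)) else 0) else 0 := by
      intro x y σ
      by_cases h : G.Adj x y
      · simp only [if_pos h, hop1]
      · simp only [if_neg h, Pi.zero_apply, ite_self, Finset.sum_const_zero]
    simp only [h1]
    -- move the sum over `l` outside
    simp only [Finset.sum_comm (t := (Finset.univ : Finset (Fin N)))]
    refine Finset.sum_congr rfl fun l _ => ?_
    rw [Finset.sum_comm]
    refine Finset.sum_congr rfl fun y _ => ?_
    exact sum_sum_ite_eq_orb (o l) (fun x σ => if G.Adj x y then g (Function.update o l (orb y σ)) else 0)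
  · rw [Finset.sum_apply]
    refine Finset.sum_congr rfl fun x _ => ?_
    rw [hop1_self_hop1_self_apply]

omit [DecidableRel G.Adj] in
/-- `|g⟩` has no component on basis vectors with the wrong numbers of up/down spins when `g`
is supported on (injective) configurations with `a` up-spin and `b` down-spin labels. [folklore] -/
theorem slater_apply_eq_zero_of_spin_count {N : ℕ} (g : (Fin N → Orb Λ) → ℂ) (a b : ℕ)
    (hg : ∀ o, Function.Injective o →
      (Finset.univ.filter fun l => (ofLex (o l)).2 = 0).card ≠ a ∨
        (Finset.univ.filter fun l => (ofLex (o l)).2 = 1).card ≠ b → g o = 0)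
    (s : Finset (Orb Λ))
    (hs : (s.filter fun i => (ofLex i).2 = 0).card ≠ a ∨ (s.filter fun i => (ofLex i).2 = 1).card ≠ b) :
    slater g s = 0 := by
  rw [slater, Finset.sum_apply]
  refine Finset.sum_eq_zero fun o _ => ?_
  rw [Pi.smul_apply, smul_eq_mul]
  by_cases hinj : Function.Injective o
  · obtain ⟨ht, π, hπ⟩ := exists_perm_eq_orderEmbOfFin_comp o hinj
    by_cases hts : Finset.univ.image o = s
    · rw [hg o hinj, zero_mul]
      have hcount : ∀ c : Fin 2, (Finset.univ.filter fun l => (ofLex (o l)).2 = c).card =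
          (s.filter fun i => (ofLex i).2 = c).card := by
        intro c
        rw [← hts, Finset.filter_image, Finset.card_image_of_injective _ hinj]
      rw [hcount 0, hcount 1]
      exact hs
    · rw [hπ, prodCreation_vacuum_apply_of_perm, if_neg hts, mul_zero]
  · rw [prodCreation_vacuum_of_not_injective o hinj, Pi.zero_apply, mul_zero]

end Hubbard


end FirstQuant

end Literature.MathematicalPhysics.QuantumLattice
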